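import Literature.MathematicalPhysics.QuantumLattice.HubbardTTPrimeSourcedMeanEnergyMinimisers
import Literature.MathematicalPhysics.QuantumLattice.ErgodicStatesODLROProofs
import Literature.MathematicalPhysics.QuantumLattice.InfVolFermionStateWeakLimits
import HarnessLib

/-!
# Translation-invariant ground states of lattice fermion systems minimise the mean energy
# (Bratteli–Kishimoto–Robinson 1978, Theorem 2, direction `1 ⇒ 2`), for every even finite-range
# translation-invariant interaction on `ℤ^d`

Topic `Literature/MathematicalPhysics/QuantumLattice`; namespace
`Literature.MathematicalPhysics.QuantumLattice` (the file path). Vocabulary of `InfVolFermionState.lean`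
§6 (`FermionInteraction`, `localHamiltonian`, `meanEnergyObs`, `InfVolFermionState.IsGroundState` = the
LOCAL Bratteli–Robinson ground-state condition `-i ω(A⋆ δ(A)) ≥ 0`, `meanEnergy`,
`IsMeanEnergyMinimiser`). Companion and converse of `MeanEnergyMinimisersAreGroundStates.lean`
(`IsMeanEnergyMinimiser.isGroundState`, the direction `2 ⇒ 1`, Ruelle 1969) and the general form of
`FermionGroundStatesMinimiseMeanEnergy.lean` §3 (which proves `1 ⇒ 2` for the `t–t'` Hubbard model
`Φ(t,t',U) − μ n` on `ℤ²` only, through a bond-by-bond bookkeeping of its box Hamiltonians).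
Everything is PROVED; no definition, no named fact.

## Main results

Let `Ψ` be an EVEN, TRANSLATION-INVARIANT interaction of FINITE RANGE `R` on the lattice fermion system
`ℤ^d` (any `d`), and put `S_Ψ := Σ_{X ∋ 0, X ⊆ Λ_R(0)} ‖Ψ X‖` (`Λ_R(0) = thicken {0} R`; every `X ∋ 0`
with `Ψ X ≠ 0` lies in `Λ_R(0)`, so this is Bratteli–Robinson's `Σ_{X ∋ 0} ‖Φ(X)‖`).

* §3 `IsTranslationInvariant.abs_card_mul_meanEnergy_sub_le` — **the mean energy versus the free-boundary
  local Hamiltonians** (Bratteli–Robinson II §6.2.4): for every translation-invariant state `ω` and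
  every finite region `Λ`,
  `| |Λ| · e_Ψ(ω) − (Re ω(H^Ψ_Λ) − Re ω(Ψ ∅)) | ≤ |thicken Λ R ∖ Λ| · S_Ψ`
  (the constant term `Ψ ∅` of `H_Λ` is invisible to the energy PER SITE; its expectation
  `ω_∅(Ψ ∅) = (Ψ ∅)_{∅∅}` is the same number for every state, `expect_empty_eq`). Behind it is the exact
  identity `|Λ| · ω(E_Ψ) = Σ_{Y ⊆ thicken Λ R} |Y ∩ Λ| |Y|⁻¹ ω(Ψ Y)`
  (`card_mul_expect_meanEnergyObs_eq`: translation invariance of `ω` AND `Ψ` makes the `|Y|⁻¹`-weighted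
  sum of the term energies through any site `x` equal to `ω(E_Ψ)`; double counting over `(x, Y ∋ x)`),
  whose part `Y ⊆ Λ` is `ω(H_Λ) − ω(Ψ ∅)` and whose part `Y ⊄ Λ` is carried by regions with a point in
  the collar `thicken Λ R ∖ Λ` (`sum_filter_not_subset_le_sum_sdiff_sum`), each collar point carrying
  norm mass `≤ S_Ψ` (`sum_filter_mem_norm_le`).
* §3 `FermionInteraction.IsTranslationInvariant.norm_crossSum_le` — **the surface energy is carried by
  the collar**: `‖W_Λ‖ ≤ |thicken Λ R ∖ Λ| · S_Ψ` for the interaction across `∂Λ`,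
  `W_Λ = Σ_{X ⊆ thicken Λ R, X ⊄ Λ, X ∩ Λ ≠ ∅} Ψ X` (the `W_Φ(Λ)` of the source, in the form used by
  `IsGroundState.re_expect_localHamiltonian_le`).
* §4 `IsGroundState.card_mul_meanEnergy_le` — **Theorem 2 `1 ⇒ 2` in finite volume**: if moreover `ω`
  is a translation-invariant GROUND STATE of `Ψ`, then for every translation-invariant `σ` and every
  finite `Λ`: `|Λ| e_Ψ(ω) ≤ |Λ| e_Ψ(σ) + 4 |thicken Λ R ∖ Λ| S_Ψ` (principle of minimum local energy
  `Re ω(H_Λ) ≤ Re σ(H_Λ) + 2‖W_Λ‖`, the tree's `IsGroundState.re_expect_localHamiltonian_le`, plus the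
  two bookkeeping bounds). On the boxes `[0,L)^d` the collar has `≤ (L + 2⌊R⌋)^d − L^d = o(L^d)` sites
  (`card_thicken_halfOpenBox_sdiff_le`), whence
* §4 `IsGroundState.isMeanEnergyMinimiser` — **every translation-invariant ground state of an even,
  translation-invariant, finite-range interaction minimises the mean energy** among all
  translation-invariant states; with `IsMeanEnergyMinimiser.isGroundState` (`2 ⇒ 1`, which needs `Ψ`
  Hermitian and `d ≥ 1`) the full printed equivalence `isMeanEnergyMinimiser_iff_isGroundState`:
  `ω` minimises `e_Ψ` **iff** `ω` is translation invariant and a ground state of `Ψ`; and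
  `IsGroundState.meanEnergy_eq_tiGroundEnergyDensity`: `e_Ψ(ω) = e₀(Ψ)`.
* §5 the equivalence BY NAME for the tree's Hubbard interactions: `isMeanEnergyMinimiser_hubbard_iff`
  (`Φ(t,U)` on `ℤ^d`, `d ≥ 1`), `isMeanEnergyMinimiser_ttPrimeMu_iff` (`Φ(t,t',U) − μ n` on `ℤ²`),
  `isMeanEnergyMinimiser_ttPrimeSourced_iff` (the pair-sourced `Φ(t,t',U) − μ n − h P_g`): at every
  source strength `h`, "translation-invariant ground state of the sourced model" and "translation-invariant
  minimiser of its mean energy" are the same class of states (the plain `t–t'` case is the tree's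
  `isMeanEnergyMinimiser_ttPrime_iff`).

## Source, and what is printed (held text `paper:doi-10-1007-bf01940760`, pp. 47–48 read)

O. Bratteli, A. Kishimoto, D. W. Robinson, *Ground states of quantum spin systems*, Commun. Math.
Phys. **64** (1978) 41–48 [BratteliKishimotoRobinson1978]. Theorem 2 (p. 47): "Let `Φ` be a
`ℤ^ν`-invariant interaction such that `‖Φ‖_λ = Σ_{X∋0} ‖Φ(X)‖ e^{λ|X|} < +∞` for some `λ > 0` and let
`τ^Φ` denote the associated dynamical group. If `ω` is a `ℤ^ν`-invariant state the following are
equivalent: 1. `ω` is a `τ^Φ`-ground state, 2. `ω` minimizes `H_Φ`." Proof of `1 ⇒ 2` (pp. 47–48):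
Theorem 1 gives `ω(H̃_Φ(Λ)) ≤ ω'(H̃_Φ(Λ))` for `ω' ∈ C_Λ^ω`; for a `ℤ^ν`-invariant `σ` take
`ω' = σ|_Λ ⊗ ω|_{Λᶜ}`, so "`ω(H_Φ(Λ)) ≤ σ(H_Φ(Λ)) + ω'(W_Φ(Λ)) − ω(W_Φ(Λ))` with
`W_Φ(Λ) = H̃_Φ(Λ) − H_Φ(Λ)`. Dividing both sides by `|Λ|` and using `lim ‖W_Φ(Λ)‖/|Λ| = 0` where
`Λ → ∞` in the sense of van Hove, one finds `H_Φ(ω) ≤ H_Φ(σ)`." The mean energy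
`H_Φ(ω) = lim ω(H_Φ(Λ))/|Λ|` of an invariant state equals `ω(E_Φ)`, `E_Φ = Σ_{X∋0} Φ(X)/|X|`
(Bratteli–Robinson II §6.2.4; Ruelle 1969 §2 eq. (4)); §3 below is the finite-range, free-boundary form
of that identity with an explicit collar error. HERE: lattice FERMIONS with an even interaction
(Bratteli–Robinson II §6.2.7 treats spins; even elements of disjoint regions commute, which is all the
product-state step uses — `FermionGroundStatesMinimiseMeanEnergy.lean` §1–§2), finite range instead of
`‖Φ‖_λ < ∞` (weaker than print, never stronger), boxes `[0,L)^d` as the van Hove sequence.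
Restated: Bratteli–Robinson II Thm. 6.2.58 [BratteliRobinsonII1997]; Koma–Tasaki, J. Stat. Phys. 76
(1994) App. A.

HONEST SCOPE: model-free statements about states and interactions of the tree; nothing is claimed about
the existence or structure of ground states of any particular model.
-/

noncomputable section

namespace Literature.MathematicalPhysics.QuantumLattice

open Matrix Finset HubbardWave0 Literature.Probability.LatticeModels _root_.Filter
open scoped ComplexOrder _root_.Topology

variable {d : ℕ}

/-! ### §1. Lattice geometry: `R`-balls around a point, translates, the collar of a box -/

/-- The `R`-neighbourhood of a point is the translated sup-norm ball: `thicken {y} R = y + box ⌊R⌋`.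
[cite: BratteliRobinsonII1997, §6.2.1 (finite range)] -/
theorem thicken_singleton_eq (y : Site d) (R : ℝ) :
    thicken ({y} : Finset (Site d)) R = (box d ⌊R⌋₊).image fun w => y + w := by
  rw [thicken, Finset.singleton_biUnion]

/-- Membership in the `R`-neighbourhood of a point: `z ∈ thicken {y} R ↔ z − y ∈ box ⌊R⌋`.
[cite: BratteliRobinsonII1997, §6.2.1] -/
theorem mem_thicken_singleton_iff {y z : Site d} {R : ℝ} :
    z ∈ thicken ({y} : Finset (Site d)) R ↔ z - y ∈ box d ⌊R⌋₊ := by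
  rw [thicken_singleton_eq, Finset.mem_image]
  constructor
  · rintro ⟨w, hw, rfl⟩
    rwa [add_sub_cancel_left]
  · intro h
    exact ⟨z - y, h, add_sub_cancel y z⟩

/-- `thicken` is monotone in the region. [cite: BratteliRobinsonII1997, §6.2.1] -/
theorem thicken_subset_thicken_of_subset {S T : Finset (Site d)} (h : S ⊆ T) (R : ℝ) :
    thicken S R ⊆ thicken T R :=
  Finset.biUnion_subset_biUnion_of_subset_left _ h

/-- **Finite range, rooted form**: a region carrying a nonzero term of an interaction of range `R` lies
in the `R`-neighbourhood of each of its points. [cite: BratteliRobinsonII1997, §6.2.1 (finite range)] -/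
theorem FermionInteraction.HasFiniteRange.subset_thicken_singleton {Ψ : FermionInteraction d} {R : ℝ}
    (hR : Ψ.HasFiniteRange R) {X : Finset (Site d)} (hX : Ψ.Φ X ≠ 0) {y : Site d} (hy : y ∈ X) :
    X ⊆ thicken ({y} : Finset (Site d)) R := by
  rw [thicken_singleton_eq]
  exact hR.subset_image_box hX hy

/-- Translating a region inside the `R`-ball at `y` gives a region inside the `R`-ball at `y + v`.
[cite: BratteliRobinsonII1997, §6.2.1 (lattice translations)] -/
theorem shiftSet_subset_thicken_singleton {X : Finset (Site d)} {y : Site d} {R : ℝ} (v : Site d)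
    (h : X ⊆ thicken ({y} : Finset (Site d)) R) :
    shiftSet v X ⊆ thicken ({y + v} : Finset (Site d)) R := by
  intro z hz
  rw [mem_shiftSet] at hz
  rw [mem_thicken_singleton_iff]
  have h' := mem_thicken_singleton_iff.1 (h hz)
  rwa [sub_sub, add_comm v y] at h'

/-- **The `R`-neighbourhood of the box `[0,L)^d` lies in a box of side `L + 2⌊R⌋`** (translated by
`−⌊R⌋` in every coordinate) — the van Hove property of boxes used in the proof of Theorem 2.
[cite: BratteliKishimotoRobinson1978, Thm. 2 (proof, p. 48: Λ → ∞ in the sense of van Hove)] -/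
theorem thicken_halfOpenBox_subset (L : ℕ) (R : ℝ) :
    thicken (halfOpenBox d L) R ⊆
      (halfOpenBox d (L + 2 * ⌊R⌋₊)).image fun z => z - fun _ => (⌊R⌋₊ : ℤ) := by
  intro y hy
  rw [mem_thicken_iff] at hy
  obtain ⟨x, hx, w, hw, rfl⟩ := hy
  rw [mem_halfOpenBox] at hx
  rw [mem_box] at hw
  refine Finset.mem_image.2 ⟨x + w + fun _ => (⌊R⌋₊ : ℤ), ?_, add_sub_cancel_right _ _⟩
  rw [mem_halfOpenBox]
  intro i
  have h1 := hx i
  have h2 := hw i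
  simp only [Pi.add_apply]
  push_cast
  omega

/-- `|thicken [0,L)^d R| ≤ (L + 2⌊R⌋)^d` (van Hove property of boxes).
[cite: BratteliKishimotoRobinson1978, Thm. 2 (proof, p. 48: Λ → ∞ in the sense of van Hove)] -/
theorem card_thicken_halfOpenBox_le (L : ℕ) (R : ℝ) :
    (thicken (halfOpenBox d L) R).card ≤ (L + 2 * ⌊R⌋₊) ^ d :=
  (Finset.card_le_card (thicken_halfOpenBox_subset L R)).trans
    (Finset.card_image_le.trans (card_halfOpenBox d _).le)

/-- **The collar of a box is `o(L^d)`**: `|thicken [0,L)^d R ∖ [0,L)^d| ≤ (L + 2⌊R⌋)^d − L^d`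
(Bratteli–Kishimoto–Robinson: `‖W_Φ(Λ)‖/|Λ| → 0` for `Λ → ∞` in the sense of van Hove; boxes suffice).
[cite: BratteliKishimotoRobinson1978, Thm. 2 (proof, p. 48)] -/
theorem card_thicken_halfOpenBox_sdiff_le (L : ℕ) (R : ℝ) :
    (thicken (halfOpenBox d L) R \ halfOpenBox d L).card ≤ (L + 2 * ⌊R⌋₊) ^ d - L ^ d := by
  rw [Finset.card_sdiff_of_subset (subset_thicken _ _), card_halfOpenBox]
  exact Nat.sub_le_sub_right (card_thicken_halfOpenBox_le L R) _

/-! ### §2. Double counting over rooted regions -/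

/-- **Fubini with multiplicities**: summing, over the sites `x` of `Λ`, a function of the regions
`Y ∋ x` of a family counts every region `|Y ∩ Λ|` times (the double counting behind
`ω(H_Φ(Λ)) = Σ_{x∈Λ} Σ_{X∋x, X⊆Λ} ω(Φ(X))/|X|`, Bratteli–Robinson II §6.2.4).
[cite: BratteliRobinsonII1997, §6.2.4 (mean energy of an invariant state)] -/
theorem sum_sum_filter_mem_eq_sum_card_inter_smul {α M : Type*} [DecidableEq α] [AddCommMonoid M]
    (Λ : Finset α) (𝒴 : Finset (Finset α)) (g : Finset α → M) :
    ∑ x ∈ Λ, ∑ Y ∈ 𝒴 with x ∈ Y, g Y = ∑ Y ∈ 𝒴, (Y ∩ Λ).card • g Y := by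
  simp_rw [Finset.sum_filter]
  rw [Finset.sum_comm]
  refine Finset.sum_congr rfl fun Y _ => ?_
  rw [Finset.sum_ite_mem, Finset.inter_comm, Finset.sum_const]

/-- **Regions not inside `Λ` are counted at least once by the sites outside `Λ`**: for `f ≥ 0`,
`Σ_{X ⊆ Λ', X ⊄ Λ} f X ≤ Σ_{x ∈ Λ' ∖ Λ} Σ_{X ⊆ Λ', X ∋ x} f X` (Bratteli–Kishimoto–Robinson's surface
terms are carried by the collar). [cite: BratteliKishimotoRobinson1978, §3 (surface energy W_Φ(Λ))] -/
theorem sum_filter_not_subset_le_sum_sdiff_sum {α : Type*} [DecidableEq α] (Λ Λ' : Finset α)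
    (f : Finset α → ℝ) (hf : ∀ X, 0 ≤ f X) :
    ∑ X ∈ Λ'.powerset with ¬ X ⊆ Λ, f X ≤ ∑ x ∈ Λ' \ Λ, ∑ X ∈ Λ'.powerset with x ∈ X, f X := by
  rw [sum_sum_filter_mem_eq_sum_card_inter_smul]
  calc ∑ X ∈ Λ'.powerset with ¬ X ⊆ Λ, f X
      ≤ ∑ X ∈ Λ'.powerset with ¬ X ⊆ Λ, (X ∩ (Λ' \ Λ)).card • f X := by
        refine Finset.sum_le_sum fun X hX => ?_
        rw [Finset.mem_filter, Finset.mem_powerset] at hX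
        obtain ⟨x, hxX, hxΛ⟩ := Finset.not_subset.1 hX.2
        have hpos : (1 : ℝ) ≤ (X ∩ (Λ' \ Λ)).card := by
          exact_mod_cast Finset.card_pos.2 ⟨x, Finset.mem_inter.2 ⟨hxX, Finset.mem_sdiff.2 ⟨hX.1 hxX, hxΛ⟩⟩⟩
        rw [nsmul_eq_mul]
        nlinarith [hf X]
    _ ≤ ∑ X ∈ Λ'.powerset, (X ∩ (Λ' \ Λ)).card • f X :=
        Finset.sum_le_sum_of_subset_of_nonneg (Finset.filter_subset _ _) fun X _ _ => nsmul_nonneg (hf X) _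

/-- **Re-rooting at the origin**: a sum over the regions `X ∋ y` inside the `R`-ball at `y` is the sum
over the regions `X ∋ 0` inside the `R`-ball at `0` of the translates `X + y`.
[cite: BratteliRobinsonII1997, §6.2.1 (lattice translations)] -/
theorem sum_thicken_singleton_eq_sum_shiftSet {M : Type*} [AddCommMonoid M] (φ : Finset (Site d) → M)
    (y : Site d) (R : ℝ) :
    ∑ X ∈ (thicken ({y} : Finset (Site d)) R).powerset with y ∈ X, φ X =
      ∑ X ∈ (thicken ({0} : Finset (Site d)) R).powerset with (0 : Site d) ∈ X, φ (shiftSet y X) := by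
  refine Finset.sum_nbij' (fun X => shiftSet (-y) X) (fun X => shiftSet y X) (fun X hX => ?_)
    (fun X hX => ?_) (fun X _ => KrausPattern.shiftSet_shiftSet_neg y X)
    (fun X _ => KrausPattern.shiftSet_neg_shiftSet y X)
    (fun X _ => by rw [KrausPattern.shiftSet_shiftSet_neg])
  · rw [Finset.mem_filter, Finset.mem_powerset] at hX ⊢
    refine ⟨?_, mem_shiftSet.2 (by simpa using hX.2)⟩
    have h := shiftSet_subset_thicken_singleton (-y) hX.1
    rwa [add_neg_cancel] at h
  · rw [Finset.mem_filter, Finset.mem_powerset] at hX ⊢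
    refine ⟨?_, mem_shiftSet.2 (by simpa using hX.2)⟩
    have h := shiftSet_subset_thicken_singleton y hX.1
    rwa [zero_add] at h

namespace FermionInteraction

variable {Ψ : FermionInteraction d} {R : ℝ}

/-- **Finite range restricts a rooted sum to the `R`-ball**: if `φ` vanishes on the regions carrying no
term, a sum of `φ` over the regions `X ∋ y` inside any `Λ' ⊇ thicken {y} R` equals the sum over the
regions inside the `R`-ball at `y`. [cite: BratteliRobinsonII1997, §6.2.1 (finite range)] -/
theorem HasFiniteRange.sum_filter_mem_eq_sum_thicken_singleton (hR : Ψ.HasFiniteRange R)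
    {M : Type*} [AddCommMonoid M] (φ : Finset (Site d) → M) (hφ : ∀ X, Ψ.Φ X = 0 → φ X = 0)
    {y : Site d} {Λ' : Finset (Site d)} (h : thicken ({y} : Finset (Site d)) R ⊆ Λ') :
    ∑ X ∈ Λ'.powerset with y ∈ X, φ X =
      ∑ X ∈ (thicken ({y} : Finset (Site d)) R).powerset with y ∈ X, φ X := by
  symm
  refine Finset.sum_subset (fun X hX => ?_) (fun X hX hX' => ?_)
  · rw [Finset.mem_filter, Finset.mem_powerset] at hX ⊢
    exact ⟨hX.1.trans h, hX.2⟩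
  · rw [Finset.mem_filter, Finset.mem_powerset] at hX hX'
    exact hφ X (by_contra fun hne => hX' ⟨hR.subset_thicken_singleton hne hX.2, hX.2⟩)

open scoped Matrix.Norms.L2Operator in
/-- **Each site carries norm mass at most `S_Ψ`**: for a translation-invariant interaction of finite
range `R`, `Σ_{X ⊆ Λ', X ∋ y} ‖Ψ X‖ ≤ Σ_{X ⊆ thicken {0} R, X ∋ 0} ‖Ψ X‖ =: S_Ψ` for every site `y`
and every finite `Λ'` (translate to the origin; `Γ(τ_y)` is norm-contractive).
[cite: BratteliRobinsonII1997, §6.2.4 (the norm Σ_{X∋0} ‖Φ(X)‖)] -/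
theorem IsTranslationInvariant.sum_filter_mem_norm_le (hT : Ψ.IsTranslationInvariant)
    (hR : Ψ.HasFiniteRange R) (y : Site d) (Λ' : Finset (Site d)) :
    ∑ X ∈ Λ'.powerset with y ∈ X, ‖Ψ.Φ X‖ ≤
      ∑ X ∈ (thicken ({0} : Finset (Site d)) R).powerset with (0 : Site d) ∈ X, ‖Ψ.Φ X‖ := by
  calc ∑ X ∈ Λ'.powerset with y ∈ X, ‖Ψ.Φ X‖
      ≤ ∑ X ∈ (Λ' ∪ thicken ({y} : Finset (Site d)) R).powerset with y ∈ X, ‖Ψ.Φ X‖ :=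
        Finset.sum_le_sum_of_subset_of_nonneg
          (Finset.filter_subset_filter _ (Finset.powerset_mono.2 Finset.subset_union_left))
          fun _ _ _ => norm_nonneg _
    _ = ∑ X ∈ (thicken ({y} : Finset (Site d)) R).powerset with y ∈ X, ‖Ψ.Φ X‖ :=
        hR.sum_filter_mem_eq_sum_thicken_singleton _ (fun X hX => by rw [hX, norm_zero])
          Finset.subset_union_right
    _ = ∑ X ∈ (thicken ({0} : Finset (Site d)) R).powerset with (0 : Site d) ∈ X,
          ‖Ψ.Φ (shiftSet y X)‖ := sum_thicken_singleton_eq_sum_shiftSet _ y R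
    _ ≤ _ := Finset.sum_le_sum fun X _ => by
        rw [hT y X]
        exact norm_fermionEmbed_le _ _

open scoped Matrix.Norms.L2Operator in
/-- **The terms not inside `Λ` have total norm at most `|collar| · S_Ψ`**:
`Σ_{X ⊆ thicken Λ R, X ⊄ Λ} ‖Ψ X‖ ≤ |thicken Λ R ∖ Λ| · S_Ψ`.
[cite: BratteliKishimotoRobinson1978, §3 (surface energy W_Φ(Λ), p. 47)] -/
theorem IsTranslationInvariant.sum_filter_not_subset_norm_le (hT : Ψ.IsTranslationInvariant)
    (hR : Ψ.HasFiniteRange R) (Λ : Finset (Site d)) :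
    ∑ X ∈ (thicken Λ R).powerset with ¬ X ⊆ Λ, ‖Ψ.Φ X‖ ≤
      ((thicken Λ R \ Λ).card : ℝ) *
        ∑ X ∈ (thicken ({0} : Finset (Site d)) R).powerset with (0 : Site d) ∈ X, ‖Ψ.Φ X‖ := by
  refine (sum_filter_not_subset_le_sum_sdiff_sum Λ (thicken Λ R) (fun X => ‖Ψ.Φ X‖)
    fun _ => norm_nonneg _).trans ?_
  refine (Finset.sum_le_sum fun y _ => hT.sum_filter_mem_norm_le hR y (thicken Λ R)).trans ?_
  rw [Finset.sum_const, nsmul_eq_mul]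

open scoped Matrix.Norms.L2Operator in
/-- **The surface energy is carried by the collar**: the interaction across `∂Λ`,
`W_Λ = Σ_{X ⊆ thicken Λ R, X ⊄ Λ, X ∩ Λ ≠ ∅} Ψ X` (embedded in `𝔄_{thicken Λ R}`, the `W` of
`IsGroundState.re_expect_localHamiltonian_le`), has `‖W_Λ‖ ≤ |thicken Λ R ∖ Λ| · S_Ψ`.
[cite: BratteliKishimotoRobinson1978, §3 (W_Φ(Λ), p. 47) and Thm. 2 (proof, p. 48)] -/
theorem IsTranslationInvariant.norm_crossSum_le (hT : Ψ.IsTranslationInvariant)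
    (hR : Ψ.HasFiniteRange R) (Λ : Finset (Site d)) :
    ‖∑ X ∈ (thicken Λ R).powerset with (¬ X ⊆ Λ ∧ ¬ Disjoint X Λ),
        (if h : X ⊆ thicken Λ R then fermionEmbed (PolySite.incl h) (Ψ.Φ X) else 0)‖ ≤
      ((thicken Λ R \ Λ).card : ℝ) *
        ∑ X ∈ (thicken ({0} : Finset (Site d)) R).powerset with (0 : Site d) ∈ X, ‖Ψ.Φ X‖ := by
  refine (norm_sum_le _ _).trans (le_trans ?_ (hT.sum_filter_not_subset_norm_le hR Λ))
  calc ∑ X ∈ (thicken Λ R).powerset with (¬ X ⊆ Λ ∧ ¬ Disjoint X Λ),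
        ‖(if h : X ⊆ thicken Λ R then fermionEmbed (PolySite.incl h) (Ψ.Φ X) else 0)‖
      ≤ ∑ X ∈ (thicken Λ R).powerset with (¬ X ⊆ Λ ∧ ¬ Disjoint X Λ), ‖Ψ.Φ X‖ :=
        Finset.sum_le_sum fun X hX => by
          rw [Finset.mem_filter, Finset.mem_powerset] at hX
          rw [dif_pos hX.1]
          exact norm_fermionEmbed_le _ _
    _ ≤ _ := Finset.sum_le_sum_of_subset_of_nonneg (fun X hX => by
          rw [Finset.mem_filter] at hX ⊢
          exact ⟨hX.1, hX.2.1⟩) fun _ _ _ => norm_nonneg _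

end FermionInteraction

/-! ### §3. The mean energy of a translation-invariant state versus its local Hamiltonians -/

namespace InfVolFermionState

variable {Ψ : FermionInteraction d} {R : ℝ} {ω : InfVolFermionState d}

/-- **The local algebra of the empty region is `ℂ`**: `ω_∅(A) = A_{∅∅}` for every state — the
expectation of an observable of the empty region does not depend on the state.
[cite: BratteliRobinsonI1987, Def. 2.6.3 (𝔄_∅ = ℂ𝟙)] -/
theorem expect_empty_eq (ω : InfVolFermionState d) (A : FermionOp (∅ : Finset (Site d))) :
    ω.expect ∅ A = A ∅ ∅ := by
  haveI : IsEmpty (Orb (PolySite (∅ : Finset (Site d)))) :=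
    ⟨fun p => Finset.notMem_empty _ (mem_lexSites.1 (ofLex p).1.2)⟩
  have hA : A = A ∅ ∅ • (1 : FermionOp (∅ : Finset (Site d))) := by
    ext s t
    rw [Finset.eq_empty_of_isEmpty s, Finset.eq_empty_of_isEmpty t, Matrix.smul_apply,
      Matrix.one_apply_eq, smul_eq_mul, mul_one]
  conv_lhs => rw [hA]
  rw [map_smul, ω.expect_one, smul_eq_mul, mul_one]

/-- The expectation of the local Hamiltonian is the sum of the term energies:
`ω(H_Λ) = Σ_{X ⊆ Λ} ω_X(Ψ X)`. [cite: BratteliRobinsonII1997, §6.2.1 (H_Φ(Λ) = Σ_{X⊆Λ} Φ(X))] -/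
theorem expect_localHamiltonian_eq_sum (ω : InfVolFermionState d) (Ψ : FermionInteraction d)
    (Λ : Finset (Site d)) :
    ω.expect Λ (Ψ.localHamiltonian Λ) = ∑ X ∈ Λ.powerset, ω.expect X (Ψ.Φ X) := by
  rw [Ψ.localHamiltonian_eq_sum, map_sum]
  refine Finset.sum_congr rfl fun X hX => ?_
  rw [Finset.mem_powerset] at hX
  rw [dif_pos hX, ω.compatible hX]

/-- **Translation invariance of `ω` and `Ψ`**: the energy of the translated term is the energy of the
term, `ω(Ψ(X + v)) = ω(Ψ X)`. [cite: BratteliKishimotoRobinson1978, Thm. 2 (ℤ^ν-invariant Φ and ω)] -/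
theorem IsTranslationInvariant.expect_apply_shiftSet (hω : ω.IsTranslationInvariant)
    (hT : Ψ.IsTranslationInvariant) (v : Site d) (X : Finset (Site d)) :
    ω.expect (shiftSet v X) (Ψ.Φ (shiftSet v X)) = ω.expect X (Ψ.Φ X) := by
  rw [hT v X]
  conv_rhs => rw [← hω v, shift_expect]

/-- **The weighted term energies through any site sum to the mean energy**: for translation-invariant
`ω` and `Ψ` (range `R`) and every `Λ' ⊇ thicken {x} R`,
`Σ_{Y ⊆ Λ', Y ∋ x} |Y|⁻¹ ω(Ψ Y) = ω(E_Ψ)` (`E_Ψ = Σ_{X ∋ 0} Ψ X/|X|`; re-root at `0`).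
[cite: Ruelle1969GroundState, §2 eq. (4)] [cite: BratteliRobinsonII1997, §6.2.4 (mean energy)] -/
theorem IsTranslationInvariant.sum_filter_mem_card_inv_mul_expect_eq (hω : ω.IsTranslationInvariant)
    (hT : Ψ.IsTranslationInvariant) (hR : Ψ.HasFiniteRange R) {x : Site d} {Λ' : Finset (Site d)}
    (h : thicken ({x} : Finset (Site d)) R ⊆ Λ') :
    ∑ Y ∈ Λ'.powerset with x ∈ Y, ((Y.card : ℂ)⁻¹ * ω.expect Y (Ψ.Φ Y)) =
      ω.expect _ (Ψ.meanEnergyObs R) := by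
  rw [hR.sum_filter_mem_eq_sum_thicken_singleton _ (fun Y hY => by rw [hY, map_zero, mul_zero]) h,
    sum_thicken_singleton_eq_sum_shiftSet, KrausPattern.expect_meanEnergyObs]
  refine Finset.sum_congr rfl fun X _ => ?_
  rw [card_shiftSet, hω.expect_apply_shiftSet hT]

/-- **The exact identity**: for translation-invariant `ω` and `Ψ` (range `R`) and every finite `Λ`,
`|Λ| · ω(E_Ψ) = Σ_{Y ⊆ thicken Λ R} |Y ∩ Λ| · |Y|⁻¹ ω(Ψ Y)` (sum the previous identity over `x ∈ Λ`
and count every region `|Y ∩ Λ|` times). [cite: BratteliRobinsonII1997, §6.2.4 (mean energy, Prop. 6.2.39 ff.)] -/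
theorem IsTranslationInvariant.card_mul_expect_meanEnergyObs_eq (hω : ω.IsTranslationInvariant)
    (hT : Ψ.IsTranslationInvariant) (hR : Ψ.HasFiniteRange R) (Λ : Finset (Site d)) :
    (Λ.card : ℂ) * ω.expect _ (Ψ.meanEnergyObs R) =
      ∑ Y ∈ (thicken Λ R).powerset, ((Y ∩ Λ).card : ℂ) * ((Y.card : ℂ)⁻¹ * ω.expect Y (Ψ.Φ Y)) := by
  have h1 : (Λ.card : ℂ) * ω.expect _ (Ψ.meanEnergyObs R) =
      ∑ x ∈ Λ, ∑ Y ∈ (thicken Λ R).powerset with x ∈ Y, ((Y.card : ℂ)⁻¹ * ω.expect Y (Ψ.Φ Y)) := by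
    rw [Finset.sum_congr rfl fun x hx => hω.sum_filter_mem_card_inv_mul_expect_eq hT hR
      (thicken_subset_thicken_of_subset (Finset.singleton_subset_iff.2 hx) R), Finset.sum_const,
      nsmul_eq_mul]
  rw [h1, sum_sum_filter_mem_eq_sum_card_inter_smul]
  simp_rw [nsmul_eq_mul]

/-- **The part inside `Λ` is the local Hamiltonian, up to the constant term**: the difference
`|Λ| ω(E_Ψ) − (ω(H_Λ) − ω(Ψ ∅))` is the sum over the regions `Y ⊆ thicken Λ R` NOT inside `Λ` of
`|Y ∩ Λ| |Y|⁻¹ ω(Ψ Y)`. [cite: BratteliRobinsonII1997, §6.2.4 (mean energy)] -/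
theorem IsTranslationInvariant.card_mul_expect_meanEnergyObs_sub_eq (hω : ω.IsTranslationInvariant)
    (hT : Ψ.IsTranslationInvariant) (hR : Ψ.HasFiniteRange R) (Λ : Finset (Site d)) :
    (Λ.card : ℂ) * ω.expect _ (Ψ.meanEnergyObs R) -
        (ω.expect Λ (Ψ.localHamiltonian Λ) - ω.expect ∅ (Ψ.Φ ∅)) =
      ∑ Y ∈ (thicken Λ R).powerset with ¬ Y ⊆ Λ,
        ((Y ∩ Λ).card : ℂ) * ((Y.card : ℂ)⁻¹ * ω.expect Y (Ψ.Φ Y)) := by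
  rw [hω.card_mul_expect_meanEnergyObs_eq hT hR Λ,
    ← Finset.sum_filter_add_sum_filter_not _ (fun Y => Y ⊆ Λ)]
  have hfilter : (thicken Λ R).powerset.filter (fun Y => Y ⊆ Λ) = Λ.powerset := by
    ext X
    simp only [Finset.mem_filter, Finset.mem_powerset]
    exact ⟨fun h => h.2, fun h => ⟨h.trans (subset_thicken Λ R), h⟩⟩
  have hA : ∑ Y ∈ (thicken Λ R).powerset with Y ⊆ Λ,
      ((Y ∩ Λ).card : ℂ) * ((Y.card : ℂ)⁻¹ * ω.expect Y (Ψ.Φ Y)) =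
        ω.expect Λ (Ψ.localHamiltonian Λ) - ω.expect ∅ (Ψ.Φ ∅) := by
    rw [hfilter, expect_localHamiltonian_eq_sum]
    have hdiff : ∑ Y ∈ Λ.powerset, (ω.expect Y (Ψ.Φ Y) -
        ((Y ∩ Λ).card : ℂ) * ((Y.card : ℂ)⁻¹ * ω.expect Y (Ψ.Φ Y))) =
        ω.expect ∅ (Ψ.Φ ∅) - (((∅ : Finset (Site d)) ∩ Λ).card : ℂ) *
          ((((∅ : Finset (Site d))).card : ℂ)⁻¹ * ω.expect ∅ (Ψ.Φ ∅)) := by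
      refine Finset.sum_eq_single_of_mem _ (Finset.empty_mem_powerset Λ) fun Y hY hne => ?_
      rw [Finset.mem_powerset] at hY
      have hc : (Y.card : ℂ) ≠ 0 :=
        Nat.cast_ne_zero.2 (Finset.card_ne_zero.2 (Finset.nonempty_iff_ne_empty.2 hne))
      rw [Finset.inter_eq_left.2 hY, mul_inv_cancel_left₀ hc, sub_self]
    rw [Finset.empty_inter, Finset.card_empty, Nat.cast_zero, zero_mul, sub_zero,
      Finset.sum_sub_distrib] at hdiff
    rw [← hdiff]
    abel
  rw [hA]
  abel

open scoped Matrix.Norms.L2Operator in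
/-- The regions not inside `Λ` contribute at most their norms: `|Y ∩ Λ| ≤ |Y|`, `|ω(Ψ Y)| ≤ ‖Ψ Y‖`.
[cite: BratteliRobinsonI1987, Prop. 2.3.11 (states are contractive)] -/
theorem norm_sum_filter_not_subset_le (ω : InfVolFermionState d) (Ψ : FermionInteraction d)
    (Λ Λ' : Finset (Site d)) :
    ‖∑ Y ∈ Λ'.powerset with ¬ Y ⊆ Λ, ((Y ∩ Λ).card : ℂ) * ((Y.card : ℂ)⁻¹ * ω.expect Y (Ψ.Φ Y))‖ ≤
      ∑ Y ∈ Λ'.powerset with ¬ Y ⊆ Λ, ‖Ψ.Φ Y‖ := by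
  refine (norm_sum_le _ _).trans (Finset.sum_le_sum fun Y hY => ?_)
  rw [Finset.mem_filter, Finset.mem_powerset] at hY
  have hne : Y.Nonempty :=
    Finset.nonempty_of_ne_empty (by rintro rfl; exact hY.2 (Finset.empty_subset _))
  have hc : (0 : ℝ) < Y.card := by exact_mod_cast hne.card_pos
  rw [norm_mul, norm_mul, norm_inv, Complex.norm_natCast, Complex.norm_natCast]
  have hcard : ((Y ∩ Λ).card : ℝ) ≤ Y.card := by
    exact_mod_cast Finset.card_le_card Finset.inter_subset_left
  calc ((Y ∩ Λ).card : ℝ) * ((Y.card : ℝ)⁻¹ * ‖ω.expect Y (Ψ.Φ Y)‖)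
      ≤ (Y.card : ℝ) * ((Y.card : ℝ)⁻¹ * ‖Ψ.Φ Y‖) :=
        mul_le_mul hcard (mul_le_mul_of_nonneg_left (ω.norm_expect_le Y (Ψ.Φ Y)) (inv_nonneg.2 hc.le))
          (by positivity) (by positivity)
    _ = ‖Ψ.Φ Y‖ := mul_inv_cancel_left₀ hc.ne' _

open scoped Matrix.Norms.L2Operator in
/-- **The mean energy versus the free-boundary local Hamiltonians** (Bratteli–Robinson II §6.2.4 in
finite-range, free-boundary form with an explicit collar error): for a translation-invariant state `ω`,
a translation-invariant interaction `Ψ` of finite range `R`, and every finite region `Λ`,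
`| |Λ| · e_Ψ(ω) − (Re ω(H^Ψ_Λ) − Re ω(Ψ ∅)) | ≤ |thicken Λ R ∖ Λ| · S_Ψ`,
`S_Ψ = Σ_{X ∋ 0, X ⊆ thicken {0} R} ‖Ψ X‖`. [cite: BratteliRobinsonII1997, §6.2.4 (Prop. 6.2.39 ff.)]
[cite: BratteliKishimotoRobinson1978, §3 (H_Φ(ω) = lim ω(H_Φ(Λ))/|Λ|, p. 47)] -/
theorem IsTranslationInvariant.abs_card_mul_meanEnergy_sub_le (hω : ω.IsTranslationInvariant)
    (hT : Ψ.IsTranslationInvariant) (hR : Ψ.HasFiniteRange R) (Λ : Finset (Site d)) :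
    |(Λ.card : ℝ) * ω.meanEnergy Ψ R -
        ((ω.expect Λ (Ψ.localHamiltonian Λ)).re - (ω.expect ∅ (Ψ.Φ ∅)).re)| ≤
      ((thicken Λ R \ Λ).card : ℝ) *
        ∑ X ∈ (thicken ({0} : Finset (Site d)) R).powerset with (0 : Site d) ∈ X, ‖Ψ.Φ X‖ := by
  have h := congrArg Complex.re (hω.card_mul_expect_meanEnergyObs_sub_eq hT hR Λ)
  rw [Complex.sub_re, Complex.sub_re, ← Complex.ofReal_natCast, Complex.re_ofReal_mul] at h
  rw [meanEnergy, h]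
  exact (Complex.abs_re_le_norm _).trans
    ((ω.norm_sum_filter_not_subset_le Ψ Λ _).trans (hT.sum_filter_not_subset_norm_le hR Λ))

/-! ### §4. Translation-invariant ground states minimise the mean energy -/

open scoped Matrix.Norms.L2Operator in
/-- **Bratteli–Kishimoto–Robinson Theorem 2, `1 ⇒ 2`, in finite volume.** If `ω` is a
translation-invariant ground state of the even, translation-invariant, finite-range (`R`) interaction
`Ψ`, then for every translation-invariant state `σ` and every finite region `Λ`:
`|Λ| e_Ψ(ω) ≤ |Λ| e_Ψ(σ) + 4 |thicken Λ R ∖ Λ| S_Ψ` (principle of minimum local energy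
`Re ω(H_Λ) ≤ Re σ(H_Λ) + 2 ‖W_Λ‖`, `‖W_Λ‖ ≤ |collar| S_Ψ`, and §3 for `ω` and `σ`; the constant terms
`ω(Ψ ∅) = σ(Ψ ∅)` cancel). [cite: BratteliKishimotoRobinson1978, Thm. 2 (proof, pp. 47–48)] -/
theorem IsGroundState.card_mul_meanEnergy_le (hgs : ω.IsGroundState Ψ R) (hE : Ψ.IsEven)
    (hT : Ψ.IsTranslationInvariant) (hR : Ψ.HasFiniteRange R) (hω : ω.IsTranslationInvariant)
    {σ : InfVolFermionState d} (hσ : σ.IsTranslationInvariant) (Λ : Finset (Site d)) :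
    (Λ.card : ℝ) * ω.meanEnergy Ψ R ≤ (Λ.card : ℝ) * σ.meanEnergy Ψ R +
      4 * (((thicken Λ R \ Λ).card : ℝ) *
        ∑ X ∈ (thicken ({0} : Finset (Site d)) R).powerset with (0 : Site d) ∈ X, ‖Ψ.Φ X‖) := by
  have h1 := hω.abs_card_mul_meanEnergy_sub_le hT hR Λ
  have h2 := hσ.abs_card_mul_meanEnergy_sub_le hT hR Λ
  have hloc := hgs.re_expect_localHamiltonian_le hE σ Λ
  have hW := hT.norm_crossSum_le hR Λ
  have h0 : ω.expect ∅ (Ψ.Φ ∅) = σ.expect ∅ (Ψ.Φ ∅) := by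
    rw [ω.expect_empty_eq, σ.expect_empty_eq]
  rw [h0] at h1
  rw [abs_le] at h1 h2
  linarith [h1.1, h1.2, h2.1, h2.2]

open scoped Matrix.Norms.L2Operator in
/-- **Bratteli–Kishimoto–Robinson Theorem 2, `1 ⇒ 2`: the mean energy of a translation-invariant ground
state is minimal.** For an even, translation-invariant interaction `Ψ` of finite range `R` on the lattice
fermion system `ℤ^d`, a translation-invariant ground state `ω` of `Ψ` and any translation-invariant
state `σ`: `e_Ψ(ω) ≤ e_Ψ(σ)` (the finite-volume inequality on the boxes `[0,L)^d`, whose collars have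
`≤ (L + 2⌊R⌋)^d − L^d = o(L^d)` sites, and `L → ∞`).
[cite: BratteliKishimotoRobinson1978, Thm. 2 (p. 47), proof pp. 47–48] -/
theorem IsGroundState.meanEnergy_le (hgs : ω.IsGroundState Ψ R) (hE : Ψ.IsEven)
    (hT : Ψ.IsTranslationInvariant) (hR : Ψ.HasFiniteRange R) (hω : ω.IsTranslationInvariant)
    {σ : InfVolFermionState d} (hσ : σ.IsTranslationInvariant) :
    ω.meanEnergy Ψ R ≤ σ.meanEnergy Ψ R := by
  set S : ℝ := ∑ X ∈ (thicken ({0} : Finset (Site d)) R).powerset with (0 : Site d) ∈ X, ‖Ψ.Φ X‖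
    with hS
  have hS0 : 0 ≤ S := Finset.sum_nonneg fun _ _ => norm_nonneg _
  set r : ℕ := ⌊R⌋₊ with hr
  -- the inequality on the box `[0,L)^d`
  have hbox : ∀ L : ℕ, (L : ℝ) ^ d * ω.meanEnergy Ψ R ≤
      (L : ℝ) ^ d * σ.meanEnergy Ψ R + 4 * ((((L + 2 * r : ℕ) : ℝ) ^ d - (L : ℝ) ^ d) * S) := by
    intro L
    have h := hgs.card_mul_meanEnergy_le hE hT hR hω hσ (halfOpenBox d L)
    rw [card_halfOpenBox, Nat.cast_pow] at h
    have hc : ((thicken (halfOpenBox d L) R \ halfOpenBox d L).card : ℝ) ≤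
        ((L + 2 * r : ℕ) : ℝ) ^ d - (L : ℝ) ^ d := by
      have h' := card_thicken_halfOpenBox_sdiff_le (d := d) L R
      have hle : L ^ d ≤ (L + 2 * r) ^ d := Nat.pow_le_pow_left (Nat.le_add_right _ _) d
      rw [← Nat.cast_pow, ← Nat.cast_pow, ← Nat.cast_sub hle]
      exact_mod_cast h'
    nlinarith [hc, hS0]
  -- `L → ∞`
  by_contra hcon
  push Not at hcon
  have hδ0 : 0 < ω.meanEnergy Ψ R - σ.meanEnergy Ψ R := sub_pos.2 hcon
  have hlim : Tendsto (fun L : ℕ => 4 * (((1 + 2 * (r : ℝ) / L) ^ d - 1) * S)) atTop (𝓝 0) := by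
    have h1 : Tendsto (fun L : ℕ => 2 * (r : ℝ) / L) atTop (𝓝 0) :=
      tendsto_const_div_atTop_nhds_zero_nat _
    have h2 := (((tendsto_const_nhds (x := (1 : ℝ))).add h1).pow d |>.sub_const 1
      |>.mul_const S).const_mul 4
    simpa using h2
  obtain ⟨L, hL1, hL2⟩ :=
    ((Filter.eventually_gt_atTop 0).and (hlim.eventually (gt_mem_nhds hδ0))).exists
  have hLpos : (0 : ℝ) < L := by exact_mod_cast hL1
  have hb := hbox L
  have hexp : ((L + 2 * r : ℕ) : ℝ) ^ d - (L : ℝ) ^ d =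
      (L : ℝ) ^ d * ((1 + 2 * (r : ℝ) / L) ^ d - 1) := by
    have h' : ((L + 2 * r : ℕ) : ℝ) = (L : ℝ) * (1 + 2 * (r : ℝ) / L) := by
      push_cast
      field_simp
    rw [h', mul_pow]
    ring
  rw [hexp] at hb
  have hLd : (0 : ℝ) < (L : ℝ) ^ d := pow_pos hLpos d
  nlinarith [mul_lt_mul_of_pos_left hL2 hLd]

/-- **Bratteli–Kishimoto–Robinson 1978, Theorem 2 (`1 ⇒ 2`) for lattice fermions: every
translation-invariant ground state of an even, translation-invariant, finite-range interaction minimises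
the mean energy** among the translation-invariant states (`IsMeanEnergyMinimiser`). No Hermiticity and
no restriction on `d` is needed for this direction. [cite: BratteliKishimotoRobinson1978, Thm. 2 (p. 47)]
[cite: BratteliRobinsonII1997, Thm. 6.2.58] -/
theorem IsGroundState.isMeanEnergyMinimiser (hgs : ω.IsGroundState Ψ R) (hR : Ψ.HasFiniteRange R)
    (hE : Ψ.IsEven) (hT : Ψ.IsTranslationInvariant) (hω : ω.IsTranslationInvariant) :
    ω.IsMeanEnergyMinimiser Ψ R :=
  ⟨hω, fun _ hσ => hgs.meanEnergy_le hE hT hR hω hσ⟩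

/-- **Bratteli–Kishimoto–Robinson 1978, Theorem 2, both directions, for lattice fermions.** For an even,
Hermitian, translation-invariant interaction `Ψ` of finite range `R` on `ℤ^d`, `d ≥ 1`, and an
infinite-volume state `ω`, the following are equivalent: (2) `ω` minimises the mean energy `e_Ψ` among
the translation-invariant states; (1) `ω` is translation invariant and a ground state of `Ψ`
(`-i ω(A⋆δ(A)) ≥ 0` for all local `A`). `2 ⇒ 1` is `IsMeanEnergyMinimiser.isGroundState` (Ruelle 1969;
`MeanEnergyMinimisersAreGroundStates.lean`), `1 ⇒ 2` is `IsGroundState.isMeanEnergyMinimiser`.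
[cite: BratteliKishimotoRobinson1978, Thm. 2 (p. 47)] [cite: Ruelle1969GroundState, Thm. 2] -/
theorem isMeanEnergyMinimiser_iff_isGroundState (hd : 0 < d) (hR : Ψ.HasFiniteRange R)
    (hH : Ψ.IsHermitian) (hE : Ψ.IsEven) (hT : Ψ.IsTranslationInvariant) :
    ω.IsMeanEnergyMinimiser Ψ R ↔ ω.IsTranslationInvariant ∧ ω.IsGroundState Ψ R :=
  ⟨fun h => ⟨h.1, h.isGroundState hd hR hH hE hT⟩, fun h => h.2.isMeanEnergyMinimiser hR hE hT h.1⟩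

/-- **A translation-invariant ground state attains the ground-state energy density**:
`e_Ψ(ω) = e₀(Ψ) := tiGroundEnergyDensity Ψ R`, the infimum of `e_Ψ` over the translation-invariant
states (Bratteli–Robinson II Thm. 6.2.58: "translationally invariant ground states … minimize the mean
energy"). [cite: BratteliRobinsonII1997, Thm. 6.2.58] -/
theorem IsGroundState.meanEnergy_eq_tiGroundEnergyDensity (hgs : ω.IsGroundState Ψ R)
    (hR : Ψ.HasFiniteRange R) (hE : Ψ.IsEven) (hT : Ψ.IsTranslationInvariant)
    (hω : ω.IsTranslationInvariant) : ω.meanEnergy Ψ R = Ψ.tiGroundEnergyDensity R :=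
  (hgs.isMeanEnergyMinimiser hR hE hT hω).meanEnergy_eq

/-! ### §5. The equivalence by name for the Hubbard interactions of the tree -/

/-- `1 ⇒ 2` for the Hubbard interaction `Φ(t,U)` on `ℤ^d`: a translation-invariant ground state
minimises the Hubbard mean energy. [cite: BratteliKishimotoRobinson1978, Thm. 2] -/
theorem IsGroundState.isMeanEnergyMinimiser_hubbard {t U : ℝ} (hω : ω.IsTranslationInvariant)
    (hgs : ω.IsGroundState (hubbardFermionInteraction d t U) 1) :
    ω.IsMeanEnergyMinimiser (hubbardFermionInteraction d t U) 1 :=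
  hgs.isMeanEnergyMinimiser (hubbardFermionInteraction_hasFiniteRange t U)
    (hubbardFermionInteraction_isEven t U) (hubbardFermionInteraction_isTranslationInvariant t U) hω

/-- **Theorem 2 for the Hubbard model on `ℤ^d`, `d ≥ 1`**: `ω` minimises the Hubbard mean energy iff
`ω` is a translation-invariant ground state of `Φ(t,U)`. [cite: BratteliKishimotoRobinson1978, Thm. 2] -/
theorem isMeanEnergyMinimiser_hubbard_iff (hd : 0 < d) {t U : ℝ} :
    ω.IsMeanEnergyMinimiser (hubbardFermionInteraction d t U) 1 ↔
      ω.IsTranslationInvariant ∧ ω.IsGroundState (hubbardFermionInteraction d t U) 1 :=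
  isMeanEnergyMinimiser_iff_isGroundState hd (hubbardFermionInteraction_hasFiniteRange t U)
    (hubbardFermionInteraction_isHermitian t U) (hubbardFermionInteraction_isEven t U)
    (hubbardFermionInteraction_isTranslationInvariant t U)

/-- `1 ⇒ 2` for the grand-canonical `t–t'` Hubbard interaction `Φ(t,t',U) − μ n` on `ℤ²`: a
translation-invariant ground state (Bratteli–Robinson condition for the dynamics of `H − μN`) minimises
the mean energy `e^{tt'} − μρ` (the tree's `isMeanEnergyMinimiser_hubbardTTPrimeMu_of_groundState` with
its local-stability hypothesis now read off `IsGroundState`). [cite: BratteliKishimotoRobinson1978, Thm. 2] -/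
theorem IsGroundState.isMeanEnergyMinimiser_ttPrimeMu {t t' U μ : ℝ} {ω : InfVolFermionState 2}
    (hω : ω.IsTranslationInvariant) (hgs : ω.IsGroundState (hubbardTTPrimeMuInteraction t t' U μ) 1) :
    ω.IsMeanEnergyMinimiser (hubbardTTPrimeMuInteraction t t' U μ) 1 :=
  hgs.isMeanEnergyMinimiser (hubbardTTPrimeMuInteraction_hasFiniteRange t t' U μ)
    (hubbardTTPrimeMuInteraction_isEven t t' U μ) (hubbardTTPrimeMuInteraction_isTranslationInvariant t t' U μ)
    hω

/-- **Theorem 2 for `Φ(t,t',U) − μ n` on `ℤ²`**: minimiser of `e^{tt'} − μρ` iff translation-invariant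
ground state of the `μ`-pencil. [cite: BratteliKishimotoRobinson1978, Thm. 2] -/
theorem isMeanEnergyMinimiser_ttPrimeMu_iff {t t' U μ : ℝ} {ω : InfVolFermionState 2} :
    ω.IsMeanEnergyMinimiser (hubbardTTPrimeMuInteraction t t' U μ) 1 ↔
      ω.IsTranslationInvariant ∧ ω.IsGroundState (hubbardTTPrimeMuInteraction t t' U μ) 1 :=
  isMeanEnergyMinimiser_iff_isGroundState two_pos (hubbardTTPrimeMuInteraction_hasFiniteRange t t' U μ)
    (hubbardTTPrimeMuInteraction_isHermitian t t' U μ) (hubbardTTPrimeMuInteraction_isEven t t' U μ)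
    (hubbardTTPrimeMuInteraction_isTranslationInvariant t t' U μ)

/-- `1 ⇒ 2` for the pair-sourced interaction `Φ(t,t',U) − μ n − h P_g` (Koma–Tasaki source): every
translation-invariant ground state of the sourced model minimises its mean energy.
[cite: BratteliKishimotoRobinson1978, Thm. 2] [cite: KomaTasaki1994, §1 (H_Λ − hO_Λ)] -/
theorem IsGroundState.isMeanEnergyMinimiser_ttPrimeSourced {t t' U μ : ℝ} {g : Site 2 → ℝ} {h : ℝ}
    {ω : InfVolFermionState 2} (hω : ω.IsTranslationInvariant)
    (hgs : ω.IsGroundState (hubbardTTPrimeSourcedInteraction t t' U μ g h) 1) :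
    ω.IsMeanEnergyMinimiser (hubbardTTPrimeSourcedInteraction t t' U μ g h) 1 :=
  hgs.isMeanEnergyMinimiser (hubbardTTPrimeSourcedInteraction_hasFiniteRange t t' U μ g h)
    (hubbardTTPrimeSourcedInteraction_isEven t t' U μ g h)
    (hubbardTTPrimeSourcedInteraction_isTranslationInvariant t t' U μ g h) hω

/-- **Theorem 2 for the pair-sourced `t–t'` Hubbard model**: at every source strength `h`, the
translation-invariant minimisers of the mean energy of `Φ(t,t',U) − μ n − h P_g` are exactly its
translation-invariant ground states. [cite: BratteliKishimotoRobinson1978, Thm. 2]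
[cite: KomaTasaki1994, §1 (H_Λ − hO_Λ)] -/
theorem isMeanEnergyMinimiser_ttPrimeSourced_iff {t t' U μ : ℝ} {g : Site 2 → ℝ} {h : ℝ}
    {ω : InfVolFermionState 2} :
    ω.IsMeanEnergyMinimiser (hubbardTTPrimeSourcedInteraction t t' U μ g h) 1 ↔
      ω.IsTranslationInvariant ∧ ω.IsGroundState (hubbardTTPrimeSourcedInteraction t t' U μ g h) 1 :=
  isMeanEnergyMinimiser_iff_isGroundState two_pos (hubbardTTPrimeSourcedInteraction_hasFiniteRange t t' U μ g h)
    (hubbardTTPrimeSourcedInteraction_isHermitian t t' U μ g h)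
    (hubbardTTPrimeSourcedInteraction_isEven t t' U μ g h)
    (hubbardTTPrimeSourcedInteraction_isTranslationInvariant t t' U μ g h)

/-! ### §6. The canonical class: ground states of `Ψ − μ n` minimise `e_Ψ` at fixed density
(appended 2026-08-27, hubbard-pc-lit-1 g4)

Ruelle 1969 §3.4 / Bratteli–Kishimoto–Robinson Thm. 2 read for the `μ`-pencil `Ψ − μ n`
(`FermionInteraction.pencil Ψ (numberInteraction d) (−μ)`, whose mean energy is `e_Ψ − μρ`,
`meanEnergy_pencil` / `meanEnergy_numberInteraction`): a translation-invariant ground state of `Ψ − μ n`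
minimises `e_Ψ − μρ` over ALL translation-invariant states, hence minimises `e_Ψ` among the
translation-invariant states of its own density — the converse of the tree's
`exists_isGroundState_pencil_number_of_canonical` (canonical-class minimiser ⇒ ground state of `Ψ − μ n`
for a supporting slope `μ`), closing the loop to an `iff` on `ℤ²` for densities in `(0, 2)`. -/

/-- **Ground states of `Ψ − μ n` minimise `e_Ψ − μρ`.** For an even, translation-invariant interaction `Ψ`
of finite range `R ≥ 0` on `ℤ^d` and a translation-invariant ground state `ω` of the `μ`-pencil
`Ψ − μ n`: `e_Ψ(ω) − μ ρ(ω) ≤ e_Ψ(σ) − μ ρ(σ)` for every translation-invariant `σ`.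
[cite: BratteliKishimotoRobinson1978, Thm. 2 (p. 47)] [cite: Ruelle1969, §3.4] -/
theorem IsGroundState.meanEnergy_sub_mul_density_le_of_pencil_number {μ : ℝ} (hR0 : 0 ≤ R)
    (hR : Ψ.HasFiniteRange R) (hE : Ψ.IsEven) (hT : Ψ.IsTranslationInvariant)
    (hω : ω.IsTranslationInvariant)
    (hgs : ω.IsGroundState (FermionInteraction.pencil Ψ (numberInteraction d) (-μ)) R)
    {σ : InfVolFermionState d} (hσ : σ.IsTranslationInvariant) :
    ω.meanEnergy Ψ R - μ * ω.density ≤ σ.meanEnergy Ψ R - μ * σ.density := by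
  have h := hgs.meanEnergy_le (FermionInteraction.isEven_pencil hE numberInteraction_isEven _)
    (FermionInteraction.isTranslationInvariant_pencil hT numberInteraction_isTranslationInvariant _)
    (FermionInteraction.hasFiniteRange_pencil hR (numberInteraction_hasFiniteRange R hR0) _) hω hσ
  rw [meanEnergy_pencil, meanEnergy_pencil, meanEnergy_numberInteraction, meanEnergy_numberInteraction] at h
  linarith

/-- **The canonical reading: a translation-invariant ground state of `Ψ − μ n` minimises `e_Ψ` among the
translation-invariant states of its own density** (it lies in the canonical class of its density).
[cite: Ruelle1969, §3.4] [cite: BratteliKishimotoRobinson1978, Thm. 2 (p. 47)] -/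
theorem IsGroundState.meanEnergy_le_of_pencil_number_of_density_eq {μ : ℝ} (hR0 : 0 ≤ R)
    (hR : Ψ.HasFiniteRange R) (hE : Ψ.IsEven) (hT : Ψ.IsTranslationInvariant)
    (hω : ω.IsTranslationInvariant)
    (hgs : ω.IsGroundState (FermionInteraction.pencil Ψ (numberInteraction d) (-μ)) R)
    {σ : InfVolFermionState d} (hσ : σ.IsTranslationInvariant) (hρ : σ.density = ω.density) :
    ω.meanEnergy Ψ R ≤ σ.meanEnergy Ψ R := by
  have h := hgs.meanEnergy_sub_mul_density_le_of_pencil_number hR0 hR hE hT hω hσ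
  rw [hρ] at h
  linarith

/-- **Canonical class `=` grand-canonical ground states, on `ℤ²`.** For an even, Hermitian,
translation-invariant interaction `Ψ` of finite range `R ≥ 0` on `ℤ²` and a translation-invariant state
`ω` of density `n ∈ (0, 2)`, the following are equivalent: (i) `ω` minimises `e_Ψ` among the
translation-invariant states of density `n` (the canonical class); (ii) for some chemical potential `μ`,
`ω` is a ground state of `Ψ − μ n`. (i ⇒ ii) is the tree's `exists_isGroundState_pencil_number_of_canonical`
(supporting slope of the convex energy–density curve, then `2 ⇒ 1`); (ii ⇒ i) is `1 ⇒ 2` of this file.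
[cite: Ruelle1969, §3.4] [cite: BratteliKishimotoRobinson1978, Thm. 2 (p. 47)] -/
theorem canonicalMinimiser_iff_exists_isGroundState_pencil_number (Ψ : FermionInteraction 2) {R : ℝ}
    (hR0 : 0 ≤ R) (hR : Ψ.HasFiniteRange R) (hH : Ψ.IsHermitian) (hE : Ψ.IsEven)
    (hT : Ψ.IsTranslationInvariant) {ω : InfVolFermionState 2} (hω : ω.IsTranslationInvariant) {n : ℝ}
    (hρ : ω.density = n) (hn0 : 0 < n) (hn2 : n < 2) :
    (∀ σ : InfVolFermionState 2, σ.IsTranslationInvariant → σ.density = n →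
        ω.meanEnergy Ψ R ≤ σ.meanEnergy Ψ R) ↔
      ∃ μ : ℝ, ω.IsGroundState (FermionInteraction.pencil Ψ (numberInteraction 2) (-μ)) R :=
  ⟨fun hmin => exists_isGroundState_pencil_number_of_canonical Ψ hR0 hR hH hE hT hω hρ hn0 hn2 hmin,
    fun ⟨_, hgs⟩ _ hσ hσn =>
      hgs.meanEnergy_le_of_pencil_number_of_density_eq hR0 hR hE hT hω hσ (hσn.trans hρ.symm)⟩

/-- **`t–t'` Hubbard model, by name**: a translation-invariant ground state of `H(t,t',U) − μN`
(`hubbardTTPrimeMuInteraction t t' U μ`, range `1`) has `e^{tt'}(ω) − μρ(ω) ≤ e^{tt'}(σ) − μρ(σ)` for every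
translation-invariant `σ` (the tree's `meanEnergy_sub_mul_density_le_of_groundState` with its local-stability
hypothesis replaced by `IsGroundState`). [cite: BratteliKishimotoRobinson1978, Thm. 2 (p. 47)] -/
theorem IsGroundState.meanEnergy_sub_mul_density_le_ttPrimeMu {t t' U μ : ℝ} {ω : InfVolFermionState 2}
    (hω : ω.IsTranslationInvariant) (hgs : ω.IsGroundState (hubbardTTPrimeMuInteraction t t' U μ) 1)
    {σ : InfVolFermionState 2} (hσ : σ.IsTranslationInvariant) :
    ω.meanEnergy (hubbardTTPrimeFermionInteraction t t' U) 1 - μ * ω.density ≤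
      σ.meanEnergy (hubbardTTPrimeFermionInteraction t t' U) 1 - μ * σ.density := by
  have h := (hgs.isMeanEnergyMinimiser_ttPrimeMu hω).2 σ hσ
  rwa [meanEnergy_hubbardTTPrimeMu, meanEnergy_hubbardTTPrimeMu] at h

/-- **`t–t'` Hubbard model, by name: a translation-invariant ground state of `H(t,t',U) − μN` has exactly
the thermodynamic ground-state energy density of its own filling**, `e^{tt'}(ω) = energyDensityTT' t t' U ρ(ω)`
(`U ≥ 0`, `0 < ρ(ω) < 2`): minimality of `e^{tt'} − μρ` against the torus-limit minimiser of density `ρ(ω)`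
(`exists_isTorusLimitOf_squareGroundStatesTT'_meanEnergy_eq`) and the variational principle
`IsTranslationInvariant.energyDensityTT'_le_meanEnergy`. (The tree's `meanEnergy_eq_energyDensityTT'_of_groundState`
is the same statement under the explicit local-stability hypothesis for `H − μN`.)
[cite: BratteliRobinsonII1997, Thm. 6.2.58] [cite: BratteliKishimotoRobinson1978, Thm. 2 (p. 47)] -/
theorem IsGroundState.meanEnergy_eq_energyDensityTT'_ttPrimeMu {t t' U μ : ℝ} {ω : InfVolFermionState 2}
    (hω : ω.IsTranslationInvariant) (hgs : ω.IsGroundState (hubbardTTPrimeMuInteraction t t' U μ) 1)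
    (hU : 0 ≤ U) (hρ0 : 0 < ω.density) (hρ2 : ω.density < 2) :
    ω.meanEnergy (hubbardTTPrimeFermionInteraction t t' U) 1 = ThermodynamicLimit.energyDensityTT' t t' U ω.density := by
  refine le_antisymm ?_ (hω.energyDensityTT'_le_meanEnergy t t' hU hρ0 hρ2)
  obtain ⟨ψ, Ls, σ, -, -, hti, -, -, -, hdens, -, he⟩ :=
    exists_isTorusLimitOf_squareGroundStatesTT'_meanEnergy_eq t t' hU hρ0.le hρ2
  rw [← he]
  have h := hgs.meanEnergy_sub_mul_density_le_ttPrimeMu hω hti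
  rw [hdens] at h
  linarith

/-! ### §7. The translation-invariant ground states: existence, a face of the invariant states, ergodic
extreme points (appended 2026-08-27, hubbard-pc-lit-1 g4)

The structural content of Bratteli–Kishimoto–Robinson's Theorem 2 for the SET of translation-invariant
ground states of an even, Hermitian, translation-invariant, finite-range interaction on `ℤ^d` (`d ≥ 1`):
it is non-empty (a minimiser of the weak-⋆ lower semicontinuous affine functional `e_Ψ` on the compact
convex set of invariant states exists, `FermionInteraction.exists_isMeanEnergyMinimiser`), it is a FACE of
the convex set of translation-invariant states (mixtures of ground states are ground states — true for
all ground states, the condition being a family of linear inequalities — and the components of a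
ground-state mixture of invariant states are ground states), and its extreme points are ERGODIC states
(Bratteli–Robinson I §4.3.1). -/

/-- **Every even, Hermitian, translation-invariant, finite-range interaction on `ℤ^d`, `d ≥ 1`, has a
translation-invariant ground state.** [cite: BratteliKishimotoRobinson1978, Thm. 2 (p. 47)]
[cite: BratteliRobinsonII1997, Thm. 6.2.58] -/
theorem _root_.Literature.MathematicalPhysics.QuantumLattice.FermionInteraction.exists_isTranslationInvariant_isGroundState
    (Ψ : FermionInteraction d) (hd : 0 < d) (hR : Ψ.HasFiniteRange R) (hH : Ψ.IsHermitian)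
    (hE : Ψ.IsEven) (hT : Ψ.IsTranslationInvariant) :
    ∃ ω : InfVolFermionState d, ω.IsTranslationInvariant ∧ ω.IsGroundState Ψ R := by
  obtain ⟨ω, hω⟩ := Ψ.exists_isMeanEnergyMinimiser R
  exact ⟨ω, hω.1, hω.isGroundState hd hR hH hE hT⟩

/-- **Mixtures of ground states are ground states** (any interaction, any ground states: the
Bratteli–Robinson condition `-i ω(A⋆δ(A)) ≥ 0` is a family of linear inequalities in `ω`).
[cite: BratteliRobinsonII1997, §6.2.7 (the set of ground states is convex)] -/
theorem IsGroundState.mix {ω₁ ω₂ : InfVolFermionState d} (h₁ : ω₁.IsGroundState Ψ R)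
    (h₂ : ω₂.IsGroundState Ψ R) (t : ℝ) (ht₀ : 0 ≤ t) (ht₁ : t ≤ 1) :
    (mix t ht₀ ht₁ ω₁ ω₂).IsGroundState Ψ R := by
  intro Λ A
  rw [mix_expect, mul_add, ← mul_assoc, ← mul_assoc, mul_comm (-Complex.I) (t : ℂ),
    mul_comm (-Complex.I) ((1 - t : ℝ) : ℂ), mul_assoc, mul_assoc]
  have ht₁' : (0 : ℝ) ≤ 1 - t := sub_nonneg.2 ht₁
  exact add_nonneg (mul_nonneg (Complex.zero_le_real.2 ht₀) (h₁ Λ A))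
    (mul_nonneg (Complex.zero_le_real.2 ht₁') (h₂ Λ A))

/-- **The translation-invariant ground states form a face of the invariant states, left component**:
if a mixture `t ω₁ + (1-t) ω₂` (`0 < t`) of translation-invariant states is a ground state, so is `ω₁`
(`d ≥ 1`; `Ψ` even, Hermitian, translation invariant, of range `R`).
[cite: BratteliKishimotoRobinson1978, Thm. 2 (p. 47)] [cite: BratteliRobinsonI1987, §4.3.1] -/
theorem IsGroundState.of_mix_left (hd : 0 < d) (hR : Ψ.HasFiniteRange R) (hH : Ψ.IsHermitian)
    (hE : Ψ.IsEven) (hT : Ψ.IsTranslationInvariant) {t : ℝ} {ht₀ : 0 ≤ t} {ht₁ : t ≤ 1} (ht : 0 < t)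
    {ω₁ ω₂ : InfVolFermionState d} (h₁ : ω₁.IsTranslationInvariant) (h₂ : ω₂.IsTranslationInvariant)
    (hgs : (InfVolFermionState.mix t ht₀ ht₁ ω₁ ω₂).IsGroundState Ψ R) : ω₁.IsGroundState Ψ R :=
  ((hgs.isMeanEnergyMinimiser hR hE hT (h₁.mix h₂ t ht₀ ht₁)).of_mix_left ht h₁ h₂).isGroundState
    hd hR hH hE hT

/-- **Face property, right component** (`t < 1`). [cite: BratteliKishimotoRobinson1978, Thm. 2 (p. 47)]
[cite: BratteliRobinsonI1987, §4.3.1] -/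
theorem IsGroundState.of_mix_right (hd : 0 < d) (hR : Ψ.HasFiniteRange R) (hH : Ψ.IsHermitian)
    (hE : Ψ.IsEven) (hT : Ψ.IsTranslationInvariant) {t : ℝ} {ht₀ : 0 ≤ t} {ht₁ : t ≤ 1} (ht : t < 1)
    {ω₁ ω₂ : InfVolFermionState d} (h₁ : ω₁.IsTranslationInvariant) (h₂ : ω₂.IsTranslationInvariant)
    (hgs : (InfVolFermionState.mix t ht₀ ht₁ ω₁ ω₂).IsGroundState Ψ R) : ω₂.IsGroundState Ψ R :=
  ((hgs.isMeanEnergyMinimiser hR hE hT (h₁.mix h₂ t ht₀ ht₁)).of_mix_right ht h₁ h₂).isGroundState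
    hd hR hH hE hT

/-- **The extreme points of the set of translation-invariant ground states are ergodic**: a
translation-invariant ground state admitting no non-trivial decomposition into translation-invariant
GROUND STATES admits none into translation-invariant states at all (`IsErgodic`), because the
translation-invariant ground states form a face. [cite: BratteliKishimotoRobinson1978, Thm. 2 (p. 47)]
[cite: BratteliRobinsonI1987, §4.3.1 (faces of E^G and ergodic states)] -/
theorem IsGroundState.isErgodic_of_extremal (hd : 0 < d) (hR : Ψ.HasFiniteRange R) (hH : Ψ.IsHermitian)
    (hE : Ψ.IsEven) (hT : Ψ.IsTranslationInvariant) (hω : ω.IsTranslationInvariant)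
    (hgs : ω.IsGroundState Ψ R)
    (hext : ∀ (t : ℝ) (ht₀ : 0 ≤ t) (ht₁ : t ≤ 1) (ω₁ ω₂ : InfVolFermionState d), 0 < t → t < 1 →
      ω₁.IsTranslationInvariant → ω₁.IsGroundState Ψ R → ω₂.IsTranslationInvariant →
        ω₂.IsGroundState Ψ R → InfVolFermionState.mix t ht₀ ht₁ ω₁ ω₂ = ω → ω₁ = ω ∧ ω₂ = ω) :
    ω.IsErgodic :=
  (hgs.isMeanEnergyMinimiser hR hE hT hω).isErgodic_of_extremal fun t ht₀ ht₁ ω₁ ω₂ ht ht' hm₁ hm₂ hmix =>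
    hext t ht₀ ht₁ ω₁ ω₂ ht ht' hm₁.1 (hm₁.isGroundState hd hR hH hE hT) hm₂.1
      (hm₂.isGroundState hd hR hH hE hT) hmix

end InfVolFermionState

end Literature.MathematicalPhysics.QuantumLattice

end
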